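import Summits.QuantumFields.YangMills.Theorems.UnitScaleTiltProp7TentQuasiInterpolantCore
import Summits.QuantumFields.YangMills.Theorems.UnitScaleTiltProp7DeltaEtaAlmostPositive
import HarnessLib

/-!
# Route `UnitScaleTilt`, crux K1 «MinimiserStabilityRegPr» (stmt-QuantumFields-19200) — route-R E′ (A′), LANE II «DIVERGENCE RECOVERY AT CURVED `W`» (★★OWNER RULING №23),
# brick (B2a), sub-pen F4 (★p1 g19 NAMER WORD №6 (3)), FILE F4-B2: **THE GRADIENT ROW OF THE COVARIANT TENT QUASI-INTERPOLANT AT THE MEMBER**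

Cell `ym3-torus` ∕ width seat `ym3-torus-px3` (gen 6).  THEOREMS ONLY (0 `def`, 0 `sorry`); `--supports stmt-QuantumFields-19200 --as helper`, count-neutral.  YM₃ on T³ is a ladder rung (R3),
not d = 4, not the Clay problem; nothing here claims [Balaban1985BackgroundPropagators] Thm 3.11, `hN06`, (REC), E′, EX or the gap.

THE ROW.  For every `l` with the pointwise description of ✓`Prop7TentQuasiInterpolantCore.exists_tentQuasiInterpolant_core` (`l(transl x₀ z) = Σ_δ Θ(Y z − δ, z) • Ad(σ_{Y z − δ}(z))⁻¹ w(Y z − δ)`),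
every unit-ball coarse transporter `T` and every pair of frame constants `θ₁, θ₂` with the member frame rows
(THIN) `‖σ_{Y z−δ}(z)·W♯(z,μ)·σ_{Y z−δ}(z+e_μ)⁻¹ − 1‖ ≤ θ₁·η` and (FAT) `‖σ_{Y z}(z)·σ_{Y z−δ}(z)⁻¹ − T(Y z − δ; treeWord δ)⁻¹‖ ≤ θ₂` (px15 g5's `…TentFrameRowsOfRegPr` at `RegPr`:
`θ₁ = 12ε`, `θ₂ = (36 + 3CT)ε`):  `‖DL2 W (toL2S l)‖² ≤ 4608·(c₀ℓ³Σ_c‖Ad(T c)w(c₊) − w(c₋)‖²) + 48(128θ₂² + 8θ₁²)·(c₀ℓ³Σ_y‖w y‖²)`.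
Per bond: ✓`Prop7CovariantTentPointwise.norm_sq_covTent_grad_le` on the eight roots below `z` (both ends of the bond read on the SAME roots by ✓`Prop7TentWeightsZd.sum_boxesBelow_eq_of_support`,
slopes `η` by ✓`abs_tensorTent_succ_sub_le`, `P δ := T(Y z − δ; treeWord δ)⁻¹`); the `η⁻¹` of (3.3) cancels the slopes and the thin defects; Frobenius vs operator norm `2`, three directions,
✓`sum_site_comp_boxOf` (`ℓ³` sites per box), ✓`Prop7CoarseStaircaseTelescoping.sum_sum_norm_sq_conjR_holT_treeWord_inv_le` (`Σ_y E(y) ≤ 24·Σ_c`), translation invariance (`Σ_y M(y) = 8·Σ_y‖w y‖²`).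

CONTENTS (ns `…Theorems.Prop7TentQuasiInterpolantGrad`): §1 `norm_sq_bond_tent_le` (per fine bond), §2 ★★★ `norm_sq_DL2_tent_le` (the row).
HONEST SCOPE.  Bookkeeping over landed lemmas; the frame rows are HYPOTHESES here; nothing of print estimated; rung R3, not Clay; YM gap NOT proved.

References: T. Bałaban, CMP **99** (1985) 389–434 [Balaban1985BackgroundPropagators] ((3.3) p.391, (3.11) p.392, (3.17)–(3.19) p.393); CMP **98** (1985) 17–51 [Balaban1985Averaging] (pp.24–25, (52)–(53) p.27);
CMP **99** (1985) 75–102 [Balaban1985RegularSpaces] (Lemma 1 (1.25) p.79).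
-/

set_option autoImplicit false

noncomputable section

open scoped InnerProductSpace Matrix.Norms.L2Operator BigOperators

namespace Summit.QuantumFields.YangMills.Theorems.Prop7TentQuasiInterpolantGrad

open Literature.MathematicalPhysics.QuantumFieldTheory.Balaban1983to89
open Literature.MathematicalPhysics.QuantumFieldTheory.Balaban1983to89.T3ContinuumYM3Torus
open Literature.MathematicalPhysics.QuantumLattice (blockMap blockBase)
open B7Prop1Explicit renaming Site → LSite
open B7Prop1Explicit (U1 axialFn axialFn_mem e e_apply treeWord hol_mem)
open B7Eq78Linearization (conjR conjR_apply conjR_smul_real)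
open B8Ineq132 (conjR_conjR norm_conjR)
open B9Eq325QprimeSingleSiteZd (blockMapIter_eq_blockMap_pow)
open B9Thm31GpAgmonDecayCoarseZd (blockMapIter_eq_iterate)
open B10Eq27TorusAxialLog (transl transl_apply pull pull_apply holT hol_pull_zero)
open B10StarCount (sum_pbond)
open T4TermwiseTorus (IsPeriodic tcls tlift tcls_tlift tcls_add tcls_apply)
open T3SectALandauChart (bgUnits eta eta_pos)
open B11Eq103H1Complex (SiteL2K BondL2K)
open Summit.QuantumFields.YangMills.Theorems.Prop7SectET3Transport (periodsT3 bondEquiv bgOfCfg val_bgOfCfg)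
open Summit.QuantumFields.YangMills.Theorems.Prop7SectET3HilbertLetters (W₂ frobEquiv toL2 toL2S DL2 DL2_apply)
open Summit.QuantumFields.YangMills.Theorems.Prop7SPrint (basePt)
open Summit.QuantumFields.YangMills.Theorems.Prop7QprimeCombBumpSectionRows (sum_site_comp_boxOf transl_tlift_sub shift_transl_eq val_pull_bgUnits pull_bgUnits_mem_U1)
open Summit.QuantumFields.YangMills.Theorems.Prop7DeltaEtaAlmostPositive (norm_toL2_sq)
open Summit.QuantumFields.YangMills.Theorems.Prop7RieszTauFrobNorm (norm_frobEquiv_symm_le)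
open Summit.QuantumFields.YangMills.Theorems.Prop7CovariantTentPointwise (norm_sq_covTent_grad_le)
open Summit.QuantumFields.YangMills.Theorems.Prop7TentWeightsZd (tensorTent_nonneg tensorTent_le_one sum_tensorTent_boxes_eq_one sum_tensorTent_boxes_succ_eq_one abs_tensorTent_succ_sub_le
  exists_offset_of_tensorTent_ne_zero sum_boxesBelow_eq_of_support)
open Summit.QuantumFields.YangMills.Theorems.Prop7CoarseStaircaseTelescoping (sum_comp_transl_eq sum_sum_norm_sq_conjR_holT_treeWord_inv_le)

section Member

variable {F : T3Family} {n K : ℕ} {c₀ : ℝ}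

/-! ## §1 The per-bond estimate -/

/-- ★ **THE COVARIANT DIFFERENCE OF THE TENT ACROSS ONE FINE BOND OF `ℤ³`**, squared: with `ℓ > 0`, `Y := ⌊z∕ℓ⌋`, unit-ball `V`, frames `σ_{Y−δ}(s) := axialFn V (ℓ(Y − δ)) s`, coarse
transporters `T` on the coarse torus (periods `Nk`) and the member frame rows THIN (`θ₁'`, per bond) ∕ FAT (`θ₂`):
`‖Ad(V(z,μ))(Σ_δ Θ(Y′−δ, z+e_μ)•Ad(σ_{Y′−δ}(z+e_μ))⁻¹ w(Y′−δ)) − Σ_δ Θ(Y−δ, z)•Ad(σ_{Y−δ}(z))⁻¹ w(Y−δ)‖² ≤ 4·2^d·ℓ⁻²·E + (16·2^d·ℓ⁻²θ₂² + 8θ₁'²)·M` (`Y′ = ⌊(z+e_μ)∕ℓ⌋`),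
`E = Σ_δ‖Ad(T(Y−δ; treeWord δ))⁻¹ w(Y−δ) − w(Y)‖²`, `M = Σ_δ‖w(Y−δ)‖²` (coarse values read at `tcls Nk`). [cite: Balaban1985Averaging, pp.24-25, (52)-(53) p.27] -/
theorem norm_sq_bond_tent_le {d : ℕ} {ℓ : ℕ} (hℓ : 0 < ℓ)
    (V : LSite d → Fin d → (Matrix (Fin 2) (Fin 2) ℂ)ˣ) (hV : ∀ x κ, V x κ ∈ U1 (Matrix (Fin 2) (Fin 2) ℂ))
    (Tst : LSite d → (Fin d → Fin 2) → (Matrix (Fin 2) (Fin 2) ℂ)ˣ) (hTst : ∀ Y δ, Tst Y δ ∈ U1 (Matrix (Fin 2) (Fin 2) ℂ))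
    (wv : LSite d → Matrix (Fin 2) (Fin 2) ℂ) {θ₁' θ₂ : ℝ}
    (z : LSite d) (μ : Fin d)
    (hthin : ∀ δ : Fin d → Fin 2,
      ‖((axialFn V (blockBase ℓ (blockMap ℓ z - fun i => ((δ i : ℕ) : ℤ))) z * V z μ * (axialFn V (blockBase ℓ (blockMap ℓ z - fun i => ((δ i : ℕ) : ℤ))) (z + e μ))⁻¹ :
        (Matrix (Fin 2) (Fin 2) ℂ)ˣ) : Matrix (Fin 2) (Fin 2) ℂ) - 1‖ ≤ θ₁')
    (hfat : ∀ δ : Fin d → Fin 2,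
      ‖((axialFn V (blockBase ℓ (blockMap ℓ z)) z * (axialFn V (blockBase ℓ (blockMap ℓ z - fun i => ((δ i : ℕ) : ℤ))) z)⁻¹ : (Matrix (Fin 2) (Fin 2) ℂ)ˣ) : Matrix (Fin 2) (Fin 2) ℂ)
        - (((Tst (blockMap ℓ z) δ)⁻¹ : (Matrix (Fin 2) (Fin 2) ℂ)ˣ) : Matrix (Fin 2) (Fin 2) ℂ)‖ ≤ θ₂) :
    ‖conjR (V z μ)
        (∑ δ : Fin d → Fin 2, (∏ i : Fin d, max 0 (1 - |((((z + e μ) i - (ℓ : ℤ) * ((blockMap ℓ (z + e μ) - fun i => ((δ i : ℕ) : ℤ)) i)) : ℤ) : ℝ) - ℓ| / ℓ)) •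
          conjR (axialFn V (blockBase ℓ (blockMap ℓ (z + e μ) - fun i => ((δ i : ℕ) : ℤ))) (z + e μ))⁻¹ (wv (blockMap ℓ (z + e μ) - fun i => ((δ i : ℕ) : ℤ))))
      - ∑ δ : Fin d → Fin 2, (∏ i : Fin d, max 0 (1 - |(((z i - (ℓ : ℤ) * ((blockMap ℓ z - fun i => ((δ i : ℕ) : ℤ)) i)) : ℤ) : ℝ) - ℓ| / ℓ)) •
          conjR (axialFn V (blockBase ℓ (blockMap ℓ z - fun i => ((δ i : ℕ) : ℤ))) z)⁻¹ (wv (blockMap ℓ z - fun i => ((δ i : ℕ) : ℤ)))‖ ^ 2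
      ≤ 4 * ((ℓ : ℝ)⁻¹) ^ 2 * 2 ^ d * ∑ δ : Fin d → Fin 2, ‖conjR (Tst (blockMap ℓ z) δ)⁻¹ (wv (blockMap ℓ z - fun i => ((δ i : ℕ) : ℤ))) - wv (blockMap ℓ z)‖ ^ 2
        + (16 * ((ℓ : ℝ)⁻¹) ^ 2 * 2 ^ d * θ₂ ^ 2 + 8 * θ₁' ^ 2) * ∑ δ : Fin d → Fin 2, ‖wv (blockMap ℓ z - fun i => ((δ i : ℕ) : ℤ))‖ ^ 2 := by
  set Y : LSite d := blockMap ℓ z with hY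
  set t : LSite d := z + e μ with ht
  -- re-index the far end on the roots below `z`
  set φ : LSite d → Matrix (Fin 2) (Fin 2) ℂ := fun Y' =>
    (∏ i : Fin d, max 0 (1 - |(((t i - (ℓ : ℤ) * Y' i) : ℤ) : ℝ) - ℓ| / ℓ)) • conjR (axialFn V (blockBase ℓ Y') t)⁻¹ (wv Y') with hφ
  have hsupp : ∀ (v : LSite d), (∀ i, 0 ≤ v i) → (∀ i, v i ≤ 1) → t = z + v → ∀ Y', φ Y' ≠ 0 → ∃ δ : Fin d → Fin 2, Y' = blockMap ℓ z - fun i => ((δ i : ℕ) : ℤ) := by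
    intro v hv0 hv1 htv Y' hne
    have hΘ : (∏ i : Fin d, max 0 (1 - |((((z + v) i - (ℓ : ℤ) * Y' i : ℤ)) : ℝ) - ℓ| / ℓ)) ≠ 0 := by
      intro h0; apply hne; rw [hφ]; simp only []; rw [htv, h0, zero_smul]
    exact exists_offset_of_tensorTent_ne_zero hℓ z v Y' hv0 hv1 hΘ
  have hreidx : ∑ δ : Fin d → Fin 2, φ (blockMap ℓ t - fun i => ((δ i : ℕ) : ℤ)) = ∑ δ : Fin d → Fin 2, φ (Y - fun i => ((δ i : ℕ) : ℤ)) := by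
    refine sum_boxesBelow_eq_of_support ℓ z t φ ?_ ?_
    · exact hsupp (e μ) (fun i => by rw [e_apply]; split_ifs <;> norm_num) (fun i => by rw [e_apply]; split_ifs <;> norm_num) rfl
    · intro Y' hne
      -- roots below `t` itself: apply the support lemma at `t` with `v = 0`
      have hΘ : (∏ i : Fin d, max 0 (1 - |((((t + 0) i - (ℓ : ℤ) * Y' i : ℤ)) : ℝ) - ℓ| / ℓ)) ≠ 0 := by
        intro h0; apply hne; rw [hφ]; simp only []; rw [add_zero] at h0; rw [h0, zero_smul]
      exact exists_offset_of_tensorTent_ne_zero hℓ t 0 Y' (fun i => le_rfl) (fun i => by simp) hΘ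
  have hfar : (∑ δ : Fin d → Fin 2, (∏ i : Fin d, max 0 (1 - |((((z + e μ) i - (ℓ : ℤ) * ((blockMap ℓ (z + e μ) - fun i => ((δ i : ℕ) : ℤ)) i)) : ℤ) : ℝ) - ℓ| / ℓ)) •
          conjR (axialFn V (blockBase ℓ (blockMap ℓ (z + e μ) - fun i => ((δ i : ℕ) : ℤ))) (z + e μ))⁻¹ (wv (blockMap ℓ (z + e μ) - fun i => ((δ i : ℕ) : ℤ))))
      = ∑ δ : Fin d → Fin 2, (∏ i : Fin d, max 0 (1 - |(((t i - (ℓ : ℤ) * ((Y - fun i => ((δ i : ℕ) : ℤ)) i)) : ℤ) : ℝ) - ℓ| / ℓ)) •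
          conjR (axialFn V (blockBase ℓ (Y - fun i => ((δ i : ℕ) : ℤ))) t)⁻¹ (wv (Y - fun i => ((δ i : ℕ) : ℤ))) := by
    rw [← ht]; exact hreidx
  rw [hfar]
  -- the generic per-bond lemma on the eight roots below `z`
  have hcard : (Finset.univ : Finset (Fin d → Fin 2)).card = 2 ^ d := by rw [Finset.card_univ, Fintype.card_fun, Fintype.card_fin, Fintype.card_fin]
  have h0vec : (fun i => ((((fun _ => (0 : Fin 2)) : Fin d → Fin 2) i : ℕ) : ℤ)) = (0 : LSite d) := by funext i; simp
  have hTw : ∀ δ, (Tst Y δ)⁻¹ ∈ U1 (Matrix (Fin 2) (Fin 2) ℂ) := fun δ => (U1 _).inv_mem (hTst Y δ)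
  have hgrad := norm_sq_covTent_grad_le (𝔸 := Matrix (Fin 2) (Fin 2) ℂ) (Finset.univ : Finset (Fin d → Fin 2))
    (fun δ => ∏ i : Fin d, max 0 (1 - |(((z i - (ℓ : ℤ) * ((Y - fun i => ((δ i : ℕ) : ℤ)) i)) : ℤ) : ℝ) - ℓ| / ℓ))
    (fun δ => ∏ i : Fin d, max 0 (1 - |(((t i - (ℓ : ℤ) * ((Y - fun i => ((δ i : ℕ) : ℤ)) i)) : ℤ) : ℝ) - ℓ| / ℓ))
    (fun δ => axialFn V (blockBase ℓ (Y - fun i => ((δ i : ℕ) : ℤ))) z)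
    (fun δ => axialFn V (blockBase ℓ (Y - fun i => ((δ i : ℕ) : ℤ))) t)
    (V z μ) (fun δ => wv (Y - fun i => ((δ i : ℕ) : ℤ))) (fun _ => 0) (fun δ => (Tst Y δ)⁻¹)
    (θ₁ := θ₁') (θ₂ := θ₂) (sl := (ℓ : ℝ)⁻¹)
    (by rw [hY]; exact sum_tensorTent_boxes_eq_one hℓ z)
    (by rw [hY, ht]; exact sum_tensorTent_boxes_succ_eq_one hℓ z μ)
    (fun δ _ => tensorTent_nonneg ℓ _)
    (fun δ _ => by
      have h := abs_tensorTent_succ_sub_le hℓ (fun i => z i - (ℓ : ℤ) * ((Y - fun i => ((δ i : ℕ) : ℤ)) i)) μ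
      have heq : ∀ i : Fin d, ((fun i => z i - (ℓ : ℤ) * ((Y - fun i => ((δ i : ℕ) : ℤ)) i)) + e μ) i = t i - (ℓ : ℤ) * ((Y - fun i => ((δ i : ℕ) : ℤ)) i) := by
        intro i; simp only [Pi.add_apply, ht]; ring
      simp only [heq] at h
      exact h)
    (fun δ _ => axialFn_mem hV _ _) (fun δ _ => axialFn_mem hV _ _) (hV z μ) (fun δ _ => hTw δ) (axialFn_mem hV _ _)
    (fun δ _ => hthin δ)
    (fun δ _ => by
      have h := hfat δ
      simp only [h0vec, sub_zero]
      exact h)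
  have hcardR : (((Finset.univ : Finset (Fin d → Fin 2)).card : ℕ) : ℝ) = 2 ^ d := by rw [hcard]; push_cast; ring
  beta_reduce at hgrad
  have h0 : (Y - fun _ : Fin d => (((0 : Fin 2) : ℕ) : ℤ)) = Y := funext fun i => sub_zero (Y i)
  rw [h0, hcardR] at hgrad
  -- arithmetic: `βt ≤ 1`
  have hβle : ∑ δ : Fin d → Fin 2, (∏ i : Fin d, max 0 (1 - |(((t i - (ℓ : ℤ) * ((Y - fun i => ((δ i : ℕ) : ℤ)) i)) : ℤ) : ℝ) - ℓ| / ℓ)) * ‖wv (Y - fun i => ((δ i : ℕ) : ℤ))‖ ^ 2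
      ≤ ∑ δ : Fin d → Fin 2, ‖wv (Y - fun i => ((δ i : ℕ) : ℤ))‖ ^ 2 :=
    Finset.sum_le_sum fun δ _ => by
      calc _ ≤ 1 * ‖wv (Y - fun i => ((δ i : ℕ) : ℤ))‖ ^ 2 := mul_le_mul_of_nonneg_right (tensorTent_le_one ℓ _) (sq_nonneg _)
        _ = _ := one_mul _
  have key : ∀ (Lh E M Mt c s a b : ℝ), Lh ≤ 4 * s ^ 2 * c * E + 16 * s ^ 2 * c * a ^ 2 * M + 8 * b ^ 2 * Mt → Mt ≤ M →
      Lh ≤ 4 * s ^ 2 * c * E + (16 * s ^ 2 * c * a ^ 2 + 8 * b ^ 2) * M := by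
    intro Lh E M Mt c s a b h1 h2
    nlinarith [mul_le_mul_of_nonneg_left h2 (by positivity : (0:ℝ) ≤ 8 * b ^ 2)]
  exact key _ _ _ _ _ _ _ _ hgrad hβle

/-! ## §2 The GRADIENT row at the member -/

variable (F : T3Family) (n K : ℕ) (c₀ : ℝ) [Fact (0 < c₀)]

/-- ★★★ **THE GRADIENT ROW OF THE COVARIANT TENT QUASI-INTERPOLANT.**  For every `l` with the pointwise description, every unit-ball coarse transporter `T` and frame constants with the
member rows (THIN) `θ₁·η` across every fine bond for each of the eight frames, (FAT) `θ₂` for the own-box frame against each neighbouring frame relative to the inverse coarse staircase of `T`: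
`‖DL2 W (toL2S l)‖² ≤ 4608·(c₀ℓ³·Σ_c ‖Ad(T c) w(c.src.shift c.dir) − w c.src‖²) + 48·(128θ₂² + 8θ₁²)·(c₀ℓ³·Σ_y ‖w y‖²)`.
[cite: Balaban1985BackgroundPropagators, (3.3) p.391, (3.11) p.392, (3.19) p.393; Balaban1985Averaging, pp.24-25, (52)-(53) p.27] -/
theorem norm_sq_DL2_tent_le (hnK : n ≤ K) (W : GaugeField (F.P K) 0 (Matrix.specialUnitaryGroup (Fin 2) ℂ))
    (T : PBond (F.P K) (K - n) → (Matrix (Fin 2) (Fin 2) ℂ)ˣ) (hT : ∀ c, T c ∈ U1 (Matrix (Fin 2) (Fin 2) ℂ)) {θ₁ θ₂ : ℝ}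
    (hthin : ∀ (z : LSite (F.P K).d) (μ : Fin (F.P K).d) (δ : Fin (F.P K).d → Fin 2),
      ‖((axialFn (pull (bgUnits F K W) (basePt F n K)) (blockBase ((F.P K).L ^ (K - n)) ((blockMap (F.P K).L)^[K - n] z - fun i => ((δ i : ℕ) : ℤ))) z
          * pull (bgUnits F K W) (basePt F n K) z μ
          * (axialFn (pull (bgUnits F K W) (basePt F n K)) (blockBase ((F.P K).L ^ (K - n)) ((blockMap (F.P K).L)^[K - n] z - fun i => ((δ i : ℕ) : ℤ))) (z + e μ))⁻¹ :
            (Matrix (Fin 2) (Fin 2) ℂ)ˣ) : Matrix (Fin 2) (Fin 2) ℂ) - 1‖ ≤ θ₁ * eta F n K)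
    (hfat : ∀ (z : LSite (F.P K).d) (δ : Fin (F.P K).d → Fin 2),
      ‖((axialFn (pull (bgUnits F K W) (basePt F n K)) (blockBase ((F.P K).L ^ (K - n)) ((blockMap (F.P K).L)^[K - n] z)) z
          * (axialFn (pull (bgUnits F K W) (basePt F n K)) (blockBase ((F.P K).L ^ (K - n)) ((blockMap (F.P K).L)^[K - n] z - fun i => ((δ i : ℕ) : ℤ))) z)⁻¹ :
            (Matrix (Fin 2) (Fin 2) ℂ)ˣ) : Matrix (Fin 2) (Fin 2) ℂ)
        - (((holT T (tcls ((F.P K).sitesPerDir (K - n)) ((blockMap (F.P K).L)^[K - n] z - fun i => ((δ i : ℕ) : ℤ))) (treeWord (fun i => ((δ i : ℕ) : ℤ))))⁻¹ :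
            (Matrix (Fin 2) (Fin 2) ℂ)ˣ) : Matrix (Fin 2) (Fin 2) ℂ)‖ ≤ θ₂)
    (w : Site (F.P K) (K - n) → Matrix (Fin 2) (Fin 2) ℂ) (l : Site (F.P K) 0 → Matrix (Fin 2) (Fin 2) ℂ)
    (hl : ∀ z : LSite (F.P K).d, l (transl (basePt F n K) z)
      = ∑ δ : Fin (F.P K).d → Fin 2,
          (∏ i : Fin (F.P K).d, max 0 (1 - |((z i - ((F.P K).L ^ (K - n) : ℕ) * (((blockMap (F.P K).L)^[K - n] z - fun i => ((δ i : ℕ) : ℤ)) i) : ℤ) : ℝ)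
              - (((F.P K).L ^ (K - n) : ℕ) : ℝ)| / (((F.P K).L ^ (K - n) : ℕ) : ℝ))) •
            conjR (axialFn (pull (bgUnits F K W) (basePt F n K)) (blockBase ((F.P K).L ^ (K - n)) ((blockMap (F.P K).L)^[K - n] z - fun i => ((δ i : ℕ) : ℤ))) z)⁻¹
              (w (tcls ((F.P K).sitesPerDir (K - n)) ((blockMap (F.P K).L)^[K - n] z - fun i => ((δ i : ℕ) : ℤ))))) :
    ‖DL2 F n K c₀ W (toL2S F K c₀ l)‖ ^ 2
      ≤ 4608 * (c₀ * ((F.L : ℝ) ^ (K - n)) ^ 3 * ∑ c : PBond (F.P K) (K - n), ‖conjR (T c) (w (c.src.shift c.dir)) - w c.src‖ ^ 2)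
        + 48 * (128 * θ₂ ^ 2 + 8 * θ₁ ^ 2) * (c₀ * ((F.L : ℝ) ^ (K - n)) ^ 3 * ∑ y : Site (F.P K) (K - n), ‖w y‖ ^ 2) := by
  haveI : NeZero (F.P K).L := ⟨by have h := F.hL.2; show F.L ≠ 0; omega⟩
  have hc₀ : 0 < c₀ := Fact.out
  have hη : 0 < eta F n K := eta_pos F n K
  set Nk : ℕ := (F.P K).sitesPerDir (K - n) with hNk
  set ℓ : ℕ := (F.P K).L ^ (K - n) with hℓ
  have hℓpos : 0 < ℓ := pos_iff_ne_zero.mpr (pow_ne_zero _ (NeZero.ne _))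
  have hit : ∀ x : LSite (F.P K).d, (blockMap (F.P K).L)^[K - n] x = blockMap ℓ x := fun x => by
    rw [← blockMapIter_eq_iterate (F.P K).L (K - n) x, blockMapIter_eq_blockMap_pow]
  have hηℓ : ((ℓ : ℕ) : ℝ)⁻¹ = eta F n K := by
    show (((F.L ^ (K - n) : ℕ) : ℝ))⁻¹ = ((F.L : ℝ)⁻¹) ^ (K - n); rw [Nat.cast_pow, inv_pow]
  set V := pull (bgUnits F K W) (basePt F n K) with hVdef
  have hV : ∀ x κ, V x κ ∈ U1 (Matrix (Fin 2) (Fin 2) ℂ) := fun x κ => pull_bgUnits_mem_U1 W (basePt F n K) x κ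
  -- the coarse staircase transporters and the coarse values, as functions of the `ℤ³` box label
  set Tst : LSite (F.P K).d → (Fin (F.P K).d → Fin 2) → (Matrix (Fin 2) (Fin 2) ℂ)ˣ :=
    fun Y δ => holT T (tcls Nk (Y - fun i => ((δ i : ℕ) : ℤ))) (treeWord (fun i => ((δ i : ℕ) : ℤ))) with hTst
  have hTstU : ∀ Y δ, Tst Y δ ∈ U1 (Matrix (Fin 2) (Fin 2) ℂ) := fun Y δ => by
    rw [hTst]; simp only []; rw [← hol_pull_zero]; exact hol_mem (fun z κ => hT _) _ _
  set wv : LSite (F.P K).d → Matrix (Fin 2) (Fin 2) ℂ := fun Y' => w (tcls Nk Y') with hwv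
  -- the coarse-site functions `E`, `M`
  set E : Site (F.P K) (K - n) → ℝ := fun y => ∑ δ : Fin (F.P K).d → Fin 2,
    ‖conjR (holT T (transl y (-fun i => ((δ i : ℕ) : ℤ))) (treeWord (fun i => ((δ i : ℕ) : ℤ))))⁻¹ (w (transl y (-fun i => ((δ i : ℕ) : ℤ)))) - w y‖ ^ 2 with hE
  set M : Site (F.P K) (K - n) → ℝ := fun y => ∑ δ : Fin (F.P K).d → Fin 2, ‖w (transl y (-fun i => ((δ i : ℕ) : ℤ)))‖ ^ 2 with hM
  have htr : ∀ (Yz : LSite (F.P K).d) (δ : Fin (F.P K).d → Fin 2), tcls Nk (Yz - fun i => ((δ i : ℕ) : ℤ)) = transl (tcls Nk Yz) (-fun i => ((δ i : ℕ) : ℤ)) := by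
    intro Yz δ; funext ν; simp only [transl_apply, tcls_apply, Pi.sub_apply, Pi.neg_apply]; push_cast; ring
  have hEY : ∀ Yz : LSite (F.P K).d, ∑ δ : Fin (F.P K).d → Fin 2, ‖conjR (Tst Yz δ)⁻¹ (wv (Yz - fun i => ((δ i : ℕ) : ℤ))) - wv Yz‖ ^ 2 = E (tcls Nk Yz) := by
    intro Yz
    refine Finset.sum_congr rfl fun δ _ => ?_
    rw [hTst, hwv]; simp only []; rw [htr]
  have hMY : ∀ Yz : LSite (F.P K).d, ∑ δ : Fin (F.P K).d → Fin 2, ‖wv (Yz - fun i => ((δ i : ℕ) : ℤ))‖ ^ 2 = M (tcls Nk Yz) := by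
    intro Yz
    refine Finset.sum_congr rfl fun δ _ => ?_
    rw [hwv]; simp only []; rw [htr]
  set C : ℝ := 128 * θ₂ ^ 2 + 8 * θ₁ ^ 2 with hC
  set X : PBond (F.P K) 0 → Matrix (Fin 2) (Fin 2) ℂ := (toL2 F K c₀).symm (DL2 F n K c₀ W (toL2S F K c₀ l)) with hX
  have hDX : DL2 F n K c₀ W (toL2S F K c₀ l) = toL2 F K c₀ X := by rw [hX, LinearEquiv.apply_symm_apply]
  have hd : (F.P K).d = 3 := T3Family.P_d F K
  have hd3 : (((F.P K).d : ℕ) : ℝ) = 3 := by exact_mod_cast hd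
  have h2d' : (2 : ℝ) ^ (F.P K).d = 8 := by rw [hd]; norm_num
  -- the per-bond bound
  have hbond : ∀ (x : Site (F.P K) 0) (μ : Fin (F.P K).d),
      ‖X ⟨x, μ⟩‖ ^ 2 ≤ 32 * E (tcls Nk ((blockMap (F.P K).L)^[K - n] (tlift (fun κ => x κ - basePt F n K κ))))
        + C * M (tcls Nk ((blockMap (F.P K).L)^[K - n] (tlift (fun κ => x κ - basePt F n K κ)))) := by
    intro x μ
    set z := tlift (fun κ => x κ - basePt F n K κ) with hz
    have hx : x = transl (basePt F n K) z := (transl_tlift_sub (basePt F n K) x).symm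
    have htgt : (⟨x, μ⟩ : PBond (F.P K) 0).tgt = transl (basePt F n K) (z + e μ) := by
      show x.shift μ = _; rw [hx, shift_transl_eq]
    have hunit : bgOfCfg F K W (bondEquiv F K ⟨x, μ⟩) = V z μ := by
      apply Units.ext
      rw [val_bgOfCfg, Equiv.symm_apply_apply, hVdef, val_pull_bgUnits, ← hx]
    have hXb : X ⟨x, μ⟩ = (((eta F n K : ℝ) : ℂ)⁻¹) • (conjR (V z μ) (l (transl (basePt F n K) (z + e μ))) - l (transl (basePt F n K) z)) := by
      rw [hX, DL2_apply, conjR_apply, htgt, hunit, ← hx]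
      congr 2
      rw [hVdef, val_pull_bgUnits, ← hx]
    rw [hXb, hl (z + e μ), hl z, norm_smul, norm_inv, Complex.norm_real, Real.norm_of_nonneg hη.le, mul_pow]
    simp only [hit]
    have hpb := norm_sq_bond_tent_le hℓpos V hV Tst hTstU wv z μ
      (θ₁' := θ₁ * eta F n K) (θ₂ := θ₂)
      (fun δ => by have h := hthin z μ δ; rw [hit] at h; exact h)
      (fun δ => by have h := hfat z δ; rw [hit] at h; exact h)
    rw [hEY, hMY] at hpb
    have h2d : (2 : ℝ) ^ (F.P K).d = 8 := by rw [hd]; norm_num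
    rw [h2d, hηℓ] at hpb
    -- `η⁻² · (4η²·8·E + (16η²·8·θ₂² + 8θ₁²η²)·M) = 32E + C·M`
    have hη0 : (eta F n K) ≠ 0 := hη.ne'
    have key : ∀ (Q Ev Mv : ℝ), Q ≤ 4 * (eta F n K) ^ 2 * 8 * Ev + (16 * (eta F n K) ^ 2 * 8 * θ₂ ^ 2 + 8 * (θ₁ * eta F n K) ^ 2) * Mv →
        ((eta F n K)⁻¹) ^ 2 * Q ≤ 32 * Ev + C * Mv := by
      intro Q Ev Mv hQ
      have hη2 : 0 < (eta F n K) ^ 2 := by positivity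
      calc ((eta F n K)⁻¹) ^ 2 * Q ≤ ((eta F n K)⁻¹) ^ 2 * (4 * (eta F n K) ^ 2 * 8 * Ev + (16 * (eta F n K) ^ 2 * 8 * θ₂ ^ 2 + 8 * (θ₁ * eta F n K) ^ 2) * Mv) :=
            mul_le_mul_of_nonneg_left hQ (by positivity)
        _ = 32 * Ev + C * Mv := by rw [hC]; field_simp; ring
    exact key _ _ _ hpb
  -- Frobenius vs operator norm, three directions, box counting
  rw [hDX, norm_toL2_sq, sum_pbond]
  have hsite : ∀ x : Site (F.P K) 0, ∑ μ : Fin (F.P K).d, ‖(frobEquiv.symm (X ⟨x, μ⟩) : W₂)‖ ^ 2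
      ≤ 6 * (32 * E (tcls Nk ((blockMap (F.P K).L)^[K - n] (tlift (fun κ => x κ - basePt F n K κ))))
        + C * M (tcls Nk ((blockMap (F.P K).L)^[K - n] (tlift (fun κ => x κ - basePt F n K κ))))) := by
    intro x
    have hpt : ∀ μ : Fin (F.P K).d, ‖(frobEquiv.symm (X ⟨x, μ⟩) : W₂)‖ ^ 2 ≤ 2 * ‖X ⟨x, μ⟩‖ ^ 2 := fun μ => by
      calc _ ≤ (Real.sqrt 2 * ‖X ⟨x, μ⟩‖) ^ 2 := pow_le_pow_left₀ (norm_nonneg _) (norm_frobEquiv_symm_le _) 2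
        _ = 2 * ‖X ⟨x, μ⟩‖ ^ 2 := by rw [mul_pow, Real.sq_sqrt (by norm_num)]
    calc ∑ μ : Fin (F.P K).d, ‖(frobEquiv.symm (X ⟨x, μ⟩) : W₂)‖ ^ 2
        ≤ ∑ _μ : Fin (F.P K).d, 2 * (32 * E (tcls Nk ((blockMap (F.P K).L)^[K - n] (tlift (fun κ => x κ - basePt F n K κ))))
            + C * M (tcls Nk ((blockMap (F.P K).L)^[K - n] (tlift (fun κ => x κ - basePt F n K κ))))) :=
          Finset.sum_le_sum fun μ _ => (hpt μ).trans (by linarith [hbond x μ])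
      _ = _ := by
          rw [Finset.sum_const, Finset.card_univ, Fintype.card_fin, nsmul_eq_mul, hd3]; ring
  have hsum := Finset.sum_le_sum fun x (_ : x ∈ Finset.univ) => hsite x
  rw [← Finset.mul_sum, sum_site_comp_boxOf F n K hnK (fun y => 32 * E y + C * M y)] at hsum
  have hLd : ((((F.P K).L ^ (F.P K).d) ^ (K - n) : ℕ) : ℝ) = ((F.L : ℝ) ^ (K - n)) ^ 3 := by
    rw [hd, show (F.P K).L = F.L from rfl]; push_cast; ring
  rw [nsmul_eq_mul, hLd] at hsum
  -- `Σ_y E ≤ 24·Σ_c`, `Σ_y M = 8·Σ_y ‖w‖²`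
  have hEsum : ∑ y : Site (F.P K) (K - n), E y ≤ 24 * ∑ c : PBond (F.P K) (K - n), ‖conjR (T c) (w (c.src.shift c.dir)) - w c.src‖ ^ 2 := by
    have h := sum_sum_norm_sq_conjR_holT_treeWord_inv_le T hT w
    rw [h2d', hd3] at h
    refine (le_of_eq ?_).trans (h.trans (le_of_eq (by norm_num)))
    rw [hE]
  have hMsum : ∑ y : Site (F.P K) (K - n), M y = 8 * ∑ y : Site (F.P K) (K - n), ‖w y‖ ^ 2 := by
    rw [hM, Finset.sum_comm]
    rw [Finset.sum_congr rfl fun δ _ => sum_comp_transl_eq (-fun i => ((δ i : ℕ) : ℤ)) (fun y => ‖w y‖ ^ 2), Finset.sum_const, Finset.card_univ, nsmul_eq_mul,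
      Fintype.card_fun, Fintype.card_fin, Fintype.card_fin]
    push_cast
    rw [h2d']
  have hsplit : ∑ y : Site (F.P K) (K - n), (32 * E y + C * M y) = 32 * ∑ y : Site (F.P K) (K - n), E y + C * ∑ y : Site (F.P K) (K - n), M y := by
    rw [Finset.sum_add_distrib, Finset.mul_sum, Finset.mul_sum]
  rw [hsplit, hMsum] at hsum
  have hC0 : 0 ≤ C := by rw [hC]; positivity
  have hℓ3 : 0 ≤ ((F.L : ℝ) ^ (K - n)) ^ 3 := by positivity
  have hW0 : 0 ≤ ∑ y : Site (F.P K) (K - n), ‖w y‖ ^ 2 := Finset.sum_nonneg fun _ _ => sq_nonneg _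
  calc c₀ * ∑ x : Site (F.P K) 0, ∑ μ : Fin (F.P K).d, ‖(frobEquiv.symm (X ⟨x, μ⟩) : W₂)‖ ^ 2
      ≤ c₀ * (6 * (((F.L : ℝ) ^ (K - n)) ^ 3 * (32 * ∑ y : Site (F.P K) (K - n), E y + C * (8 * ∑ y : Site (F.P K) (K - n), ‖w y‖ ^ 2)))) :=
        mul_le_mul_of_nonneg_left hsum hc₀.le
    _ ≤ c₀ * (6 * (((F.L : ℝ) ^ (K - n)) ^ 3 * (32 * (24 * ∑ c : PBond (F.P K) (K - n), ‖conjR (T c) (w (c.src.shift c.dir)) - w c.src‖ ^ 2)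
          + C * (8 * ∑ y : Site (F.P K) (K - n), ‖w y‖ ^ 2)))) := by gcongr
    _ = _ := by ring

end Member

end Summit.QuantumFields.YangMills.Theorems.Prop7TentQuasiInterpolantGrad

end
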